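import Literature.NumberTheory.Transcendental.BrumerPadicAnalytic
import Literature.NumberTheory.Transcendental.BakerLogarithmsAuxiliary
import Mathlib.RingTheory.Algebraic.Basic
import HarnessLib

/-!
# Brumer's `p`-adic analogue of Baker's theorem — the set-up and the auxiliary function

Topic `Literature/NumberTheory/Transcendental`; namespace
`Literature.NumberTheory.Transcendental.BrumerPadic`.  Second support file for the proof of the
named fact `Literature.NumberTheory.Transcendental.brumer1967_thm1` (`BrumerPadicBaker.lean`;
A. Brumer, Mathematika **14** (1967), Theorem 1: the `p`-adic analogue of Baker's theorem on the
linear independence of logarithms of algebraic numbers).  The proof is Baker's (A. Baker,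
*Transcendental Number Theory*, 1975, Ch. 2 §§3–4; formalised over `ℂ` in the tree's
`BakerLogarithmsAuxiliary.lean`, which this file ports) in the HOMOGENEOUS case and with a
`p`-adic variable.

## The normal form (Baker 1975, Ch. 2 §3, eq. (1), homogeneous case)

A counterexample to Brumer's theorem is normalised (in `BrumerPadicBaker.lean`) to a `Setup` over a
complete ultrametric normed `ℚ_p`-algebra field `𝕂` (we use `ℂ_p`): numbers `ℓ₀, …, ℓₙ ∈ 𝕂` of norm
`< p⁻¹`, linearly independent over `ℚ`, with `αᵢ = exp (p ℓᵢ)` algebraic over `ℚ` (so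
`p ℓᵢ = log_p αᵢ`), and algebraic `β₀, …, β_{n-1}` of norm `≤ 1` with
`β₀ ℓ₀ + ⋯ + β_{n-1} ℓ_{n-1} = ℓₙ`.  (Dividing a relation by its `p`-adically largest coefficient
makes the other coefficients integral; replacing `αᵢ` by `αᵢ^{p^κ}` makes the logarithms small.)

## The auxiliary function (Baker 1975, Ch. 2, Lemma 2 and eq. (5), (7); `p`-adic variable)

For integer coefficients `c(λ)`, `λ ∈ Idx n L = [0, L]^{n+1}`, and a multi-index `m ∈ ℕⁿ` of
derivatives in Baker's free variables `z₀, …, z_{n-1}`, the diagonal function is the exponential sum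
`F c m (u) = ∑_λ c(λ) · ∏ᵣ (γᵣ ℓᵣ)^{mᵣ} · exp (ψ_λ u)`, `γᵣ = λᵣ + λₙ βᵣ`, `ψ_λ = ∑ᵢ λᵢ ℓᵢ`
(`= ∑ᵣ γᵣ ℓᵣ` by the relation, `w_eq_sum_γ`) — Baker's `f(z) = Φ_{m}(z, …, z)` in closed form, the
variable scaled so that the integer points `l` of the source are the points `u = l·p` of the disc
`‖u‖ ≤ p⁻¹`.  PROVED here:

* `Setup.hasDerivAt_F` — `(d/du) F_m = ∑ᵣ F_{m+eᵣ}` on the closed unit disc (the chain rule of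
  Baker 1975, p. 23), `Setup.iteratedDeriv_F_eq_zero` — vanishing of all `F_{m'}(a)`, `|m'| ≤ T`,
  gives vanishing of `F_m^{(j)}(a)` for `|m| + j ≤ T` (Lemma 4, p. 23);
* `Setup.F_natMul` — **the values at the points `l·p`**:
  `F c m (l p) = P_m · ∑_λ c(λ) ∏ᵣ γᵣ^{mᵣ} ∏ᵢ αᵢ^{λᵢ l}` with `P_m = ∏ ℓᵣ^{mᵣ}` (Baker's display on
  p. 22; the second factor is an algebraic number, studied in `BrumerPadicField.lean`);
* `Setup.norm_F_natMul_le_of_vanishing` — **the `p`-adic extrapolation estimate** replacing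
  Lemma 4's maximum-modulus step: if `F c m' (l p) = 0` for `1 ≤ l ≤ P₀` and `|m'| ≤ T`, then for
  `|m| + S ≤ T + 1` and every `l'`, `‖F c m (l' p)‖ ≤ ‖P_m‖ · p^{-P₀ S}` (ultrametric Schwarz lemma
  for exponential sums, `BrumerPadicAnalytic`, the coefficients having norm `≤ ‖P_m‖` because
  `c(λ) ∈ ℤ`, `‖γᵣ‖ ≤ 1`, and all points `l p` lying in the disc `‖u‖ ≤ p⁻¹`).

No named facts; the definitions are the data of the proof.

## References

* [Brumer1967] A. Brumer, *On the units of algebraic number fields*, Mathematika 14 (1967),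
  121–124, Theorem 1.
* [BakerTNT1975] A. Baker, *Transcendental Number Theory*, CUP 1975, Ch. 2 §3 (eq. (1)),
  Lemma 2 (eq. (5)), Lemma 3 (p. 22), Lemma 4 (p. 23).
-/

noncomputable section

open NormedSpace Filter Metric Finset
open _root_.Topology
open scoped Nat
-- the multi-index `m + eᵢ` and its two API lemmas are shared with the complex proof
open Literature.NumberTheory.Transcendental.Baker1975 (bump bump_apply sum_bump)

namespace Literature.NumberTheory.Transcendental

namespace BrumerPadic

variable {p : ℕ} [Fact p.Prime]

/-! ### The index set (multi-indices `bump m i = m + eᵢ` are `Baker1975.bump`) -/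

/-- The index set `[0, L]^{n+1}` of the coefficients `c(λ₀, …, λₙ)` of the auxiliary function
(Baker's `p(λ₁, …, λₙ)`, Ch. 2, Lemma 2). [cite: BakerTNT1975, Ch. 2 Lemma 2] -/
abbrev Idx (n L : ℕ) := Fin (n + 1) → Fin (L + 1)

/-- `#Idx = (L+1)^{n+1}` (Baker's number of unknowns `N`, p. 22). [cite: BakerTNT1975, Ch. 2 Lemma 2] -/
theorem card_Idx (n L : ℕ) : Fintype.card (Idx n L) = (L + 1) ^ (n + 1) := by
  simp [Idx]

/-! ### The exponential of a non-negative integer combination -/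

section ExpSum

variable {E : Type*} [NontriviallyNormedField E] [NormedAlgebra ℚ_[p] E] [CompleteSpace E]
  [IsUltrametricDist E]

/-- `exp (∑ kᵢ aᵢ) = ∏ (exp aᵢ)^{kᵢ}` for natural numbers `kᵢ` and `‖aᵢ‖ ≤ ρ < p⁻¹` (functional
equation of the `p`-adic exponential on its ball, applied termwise). [folklore] -/
theorem exp_sum_natCast_mul {ι : Type*} (t : Finset ι) (a : ι → E) (k : ι → ℕ) {ρ : ℝ}
    (hρ0 : 0 ≤ ρ) (hρ : ρ < (p : ℝ)⁻¹) (ha : ∀ i ∈ t, ‖a i‖ ≤ ρ) :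
    exp (∑ i ∈ t, (k i : E) * a i) = ∏ i ∈ t, exp (a i) ^ k i := by
  classical
  induction t using Finset.induction_on with
  | empty => simp
  | insert j t hj ih =>
    have haj : ‖a j‖ < (p : ℝ)⁻¹ := (ha j (mem_insert_self j t)).trans_lt hρ
    have hkj : ‖(k j : E) * a j‖ < (p : ℝ)⁻¹ := by
      rw [norm_mul]
      exact (mul_le_of_le_one_left (norm_nonneg _)
        (IwasawaLog.norm_natCast_le_one p (F := E) _)).trans_lt haj
    have hrest : ‖∑ i ∈ t, (k i : E) * a i‖ < (p : ℝ)⁻¹ := by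
      refine (IsUltrametricDist.norm_sum_le_of_forall_le_of_nonneg hρ0 fun i hi => ?_).trans_lt hρ
      rw [norm_mul]
      exact (mul_le_of_le_one_left (norm_nonneg _)
        (IwasawaLog.norm_natCast_le_one p (F := E) _)).trans (ha i (mem_insert_of_mem hi))
    rw [sum_insert hj, prod_insert hj, PadicExp.exp_add (ℓ := p) hkj hrest,
      PadicExp.exp_natCast_mul (ℓ := p) haj, ih fun i hi => ha i (mem_insert_of_mem hi)]

end ExpSum

/-! ### The data of the normal form -/

/-- **The data of a normalised counterexample to Brumer's theorem** (the homogeneous case of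
Baker 1975, Ch. 2 §3, eq. (1), `p`-adically): `n + 1` numbers `ℓᵢ` of a complete normed
`ℚ_p`-algebra field `𝕂` with `‖ℓᵢ‖ < p⁻¹`, linearly independent over `ℚ`, such that the
`αᵢ = exp (p ℓᵢ)` are algebraic over `ℚ` (so `p ℓᵢ = log_p αᵢ`), and algebraic `βᵣ` (`r < n`) with
`‖βᵣ‖ ≤ 1` and `∑ᵣ βᵣ ℓᵣ = ℓₙ`.  The proof of Brumer's theorem derives `False` from a `Setup`.
[cite: BakerTNT1975, Ch. 2 §3, eq. (1)] [cite: Brumer1967, Theorem 1] -/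
structure Setup (p : ℕ) [Fact p.Prime] (𝕂 : Type*) [NontriviallyNormedField 𝕂] [CharZero 𝕂]
    [NormedAlgebra ℚ_[p] 𝕂] where
  /-- the number of logarithms is `n + 1` -/
  n : ℕ
  /-- the (scaled) logarithms `ℓᵢ = p⁻¹ log_p αᵢ` -/
  ℓ : Fin (n + 1) → 𝕂
  /-- the coefficients `βᵣ` of the relation -/
  β : Fin n → 𝕂
  norm_ℓ : ∀ i, ‖ℓ i‖ < (p : ℝ)⁻¹
  norm_β : ∀ r, ‖β r‖ ≤ 1
  linearIndependent : LinearIndependent ℚ ℓ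
  isAlgebraic_exp : ∀ i, IsAlgebraic ℚ (exp ((p : 𝕂) * ℓ i))
  isAlgebraic_β : ∀ r, IsAlgebraic ℚ (β r)
  rel : ∑ r : Fin n, β r * ℓ (Fin.castSucc r) = ℓ (Fin.last n)

namespace Setup

variable {𝕂 : Type*} [NontriviallyNormedField 𝕂] [CharZero 𝕂] [NormedAlgebra ℚ_[p] 𝕂]
variable (S : Setup p 𝕂) {L : ℕ}

/-- The algebraic numbers `αᵢ = exp (p ℓᵢ)`. [cite: BakerTNT1975, Ch. 2 §3] -/
def α (i : Fin (S.n + 1)) : 𝕂 := exp ((p : 𝕂) * S.ℓ i)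

/-- `ψ_λ = ∑ᵢ λᵢ ℓᵢ` (Baker 1975, p. 26, the frequencies of the auxiliary function).
[cite: BakerTNT1975, Ch. 2 §5] -/
def w (v : Idx S.n L) : 𝕂 := ∑ i, ((v i : ℕ) : 𝕂) * S.ℓ i

/-- `γᵣ = λᵣ + λₙ βᵣ` (Baker 1975, p. 21). [cite: BakerTNT1975, Ch. 2 Lemma 2] -/
def γ (v : Idx S.n L) (r : Fin S.n) : 𝕂 :=
  ((v (Fin.castSucc r) : ℕ) : 𝕂) + ((v (Fin.last S.n) : ℕ) : 𝕂) * S.β r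

/-- The factor `∏ᵣ (γᵣ ℓᵣ)^{mᵣ}` produced by `mᵣ` differentiations in `zᵣ` (Baker 1975, eq. (5),
p. 21). [cite: BakerTNT1975, Ch. 2 Lemma 2, eq. (5)] -/
def A (v : Idx S.n L) (m : Fin S.n → ℕ) : 𝕂 :=
  ∏ r : Fin S.n, (S.γ v r * S.ℓ (Fin.castSucc r)) ^ m r

/-- `P_m = ∏ᵣ ℓᵣ^{mᵣ}` (Baker's `P`, p. 22). [cite: BakerTNT1975, Ch. 2 Lemma 3] -/
def P (m : Fin S.n → ℕ) : 𝕂 := ∏ r : Fin S.n, S.ℓ (Fin.castSucc r) ^ m r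

/-- **The auxiliary function** `f(u) = Φ_m(u, …, u) = ∑_λ c(λ) ∏ᵣ (γᵣℓᵣ)^{mᵣ} exp (ψ_λ u)`
(Baker 1975, Lemma 2 and eq. (7), homogeneous case, `p`-adic variable `u`; the relation (1) is
used to write `∏ᵣ αᵣ^{γᵣ z}` as `exp (ψ_λ u)`).  Coefficients `c : Idx → ℤ`, multi-index
`m ∈ ℕⁿ`. [cite: BakerTNT1975, Ch. 2 Lemmas 2–3, eq. (7)] -/
def F (c : Idx S.n L → ℤ) (m : Fin S.n → ℕ) (z : 𝕂) : 𝕂 :=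
  ∑ u, ((c u : 𝕂) * S.A u m) * exp (S.w u * z)

/-! ### Sizes -/

/-- `ρ = maxᵢ ‖ℓᵢ‖`. [folklore] -/
def ρ : ℝ := Finset.univ.sup' Finset.univ_nonempty fun i => ‖S.ℓ i‖

/-- `ρ < p⁻¹`. [folklore] -/
theorem ρ_lt : S.ρ < (p : ℝ)⁻¹ :=
  (Finset.sup'_lt_iff _).mpr fun i _ => S.norm_ℓ i

/-- `‖ℓᵢ‖ ≤ ρ`. [folklore] -/
theorem norm_ℓ_le_ρ (i : Fin (S.n + 1)) : ‖S.ℓ i‖ ≤ S.ρ :=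
  Finset.le_sup' (fun i => ‖S.ℓ i‖) (mem_univ i)

/-- `0 ≤ ρ`. [folklore] -/
theorem ρ_nonneg : 0 ≤ S.ρ := (norm_nonneg _).trans (S.norm_ℓ_le_ρ 0)

/-- `‖p ℓᵢ‖ < p⁻¹` (indeed `< p⁻²`), so `αᵢ = exp (p ℓᵢ)` is in the domain of the exponential.
[folklore] -/
theorem norm_p_mul_ℓ_lt (i : Fin (S.n + 1)) : ‖(p : 𝕂) * S.ℓ i‖ < (p : ℝ)⁻¹ := by
  rw [norm_mul]
  exact (mul_le_of_le_one_left (norm_nonneg _)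
    (IwasawaLog.norm_natCast_le_one p (F := 𝕂) p)).trans_lt (S.norm_ℓ i)

/-- The logarithms are non-zero (they are linearly independent over `ℚ`). [folklore] -/
theorem ℓ_ne_zero (i : Fin (S.n + 1)) : S.ℓ i ≠ 0 :=
  S.linearIndependent.ne_zero i

/-- `P_m ≠ 0`. [folklore] -/
theorem P_ne_zero (m : Fin S.n → ℕ) : S.P m ≠ 0 :=
  prod_ne_zero_iff.mpr fun _ _ => pow_ne_zero _ (S.ℓ_ne_zero _)

variable [IsUltrametricDist 𝕂]

/-- `‖ψ_λ‖ ≤ ρ` (ultrametric; the `λᵢ` are integers). [folklore] -/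
theorem norm_w_le (v : Idx S.n L) : ‖S.w v‖ ≤ S.ρ :=
  IsUltrametricDist.norm_sum_le_of_forall_le_of_nonneg S.ρ_nonneg fun i _ => by
    rw [norm_mul]
    exact (mul_le_of_le_one_left (norm_nonneg _)
      (IwasawaLog.norm_natCast_le_one p (F := 𝕂) _)).trans (S.norm_ℓ_le_ρ i)

/-- `‖ψ_λ‖ < p⁻¹`. [folklore] -/
theorem norm_w_lt (v : Idx S.n L) : ‖S.w v‖ < (p : ℝ)⁻¹ :=
  (S.norm_w_le v).trans_lt S.ρ_lt

/-- `‖γᵣ‖ ≤ 1` (the `βᵣ` are `p`-adic integers). [folklore] -/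
theorem norm_γ_le (v : Idx S.n L) (r : Fin S.n) : ‖S.γ v r‖ ≤ 1 := by
  unfold γ
  refine (IsUltrametricDist.norm_add_le_max _ _).trans (max_le ?_ ?_)
  · exact IwasawaLog.norm_natCast_le_one p (F := 𝕂) _
  · rw [norm_mul]
    exact mul_le_one₀ (IwasawaLog.norm_natCast_le_one p (F := 𝕂) _) (norm_nonneg _) (S.norm_β r)

/-- `‖∏ᵣ (γᵣ ℓᵣ)^{mᵣ}‖ ≤ ‖P_m‖`. [folklore] -/
theorem norm_A_le (v : Idx S.n L) (m : Fin S.n → ℕ) : ‖S.A v m‖ ≤ ‖S.P m‖ := by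
  unfold A P
  rw [norm_prod, norm_prod]
  refine prod_le_prod (fun r _ => norm_nonneg _) fun r _ => ?_
  rw [norm_pow, norm_pow, norm_mul]
  exact pow_le_pow_left₀ (by positivity)
    (mul_le_of_le_one_left (norm_nonneg _) (S.norm_γ_le v r)) _

/-- The coefficients `c(λ) ∏ᵣ (γᵣℓᵣ)^{mᵣ}` of the exponential sum `F c m` have norm `≤ ‖P_m‖`
(`c(λ) ∈ ℤ`). [folklore] -/
theorem norm_coeff_le (c : Idx S.n L → ℤ) (u : Idx S.n L) (m : Fin S.n → ℕ) :
    ‖(c u : 𝕂) * S.A u m‖ ≤ ‖S.P m‖ := by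
  rw [norm_mul]
  exact (mul_le_of_le_one_left (norm_nonneg _)
    (PadicExp.norm_intCast_le_one (ℓ := p) (c u))).trans (S.norm_A_le u m)

/-! ### The relation and the derivative of `F` -/

omit [IsUltrametricDist 𝕂] in
/-- The relation (1) in the form used for differentiation: `ψ_λ = ∑ᵣ γᵣ ℓᵣ`.
[cite: BakerTNT1975, Ch. 2 §3, eq. (1)] -/
theorem w_eq_sum_γ (v : Idx S.n L) : S.w v = ∑ r, S.γ v r * S.ℓ (Fin.castSucc r) := by
  rw [w, Fin.sum_univ_castSucc]
  simp only [γ, add_mul, sum_add_distrib]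
  rw [← S.rel, mul_sum]
  congr 1
  exact sum_congr rfl fun r _ => by ring

omit [IsUltrametricDist 𝕂] in
/-- `A (m + eᵣ) = A m · γᵣ ℓᵣ`. [folklore] -/
theorem A_bump (v : Idx S.n L) (m : Fin S.n → ℕ) (r : Fin S.n) :
    S.A v (bump m r) = S.A v m * (S.γ v r * S.ℓ (Fin.castSucc r)) := by
  unfold A
  have h : ∀ r' : Fin S.n, (S.γ v r' * S.ℓ (Fin.castSucc r')) ^ bump m r r' =
      (S.γ v r' * S.ℓ (Fin.castSucc r')) ^ m r' *
        (if r' = r then S.γ v r * S.ℓ (Fin.castSucc r) else 1) := by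
    intro r'
    rw [bump_apply, pow_add]
    congr 1
    by_cases hr : r' = r
    · subst hr; simp
    · rw [if_neg hr, if_neg hr, pow_zero]
  simp_rw [h]
  rw [prod_mul_distrib, prod_ite_eq' univ r, if_pos (mem_univ r)]

omit [IsUltrametricDist 𝕂] in
/-- `A m = (∏ᵣ γᵣ^{mᵣ}) · P_m`. [folklore] -/
theorem A_eq (v : Idx S.n L) (m : Fin S.n → ℕ) :
    S.A v m = (∏ r, S.γ v r ^ m r) * S.P m := by
  unfold A P
  rw [← prod_mul_distrib]
  exact prod_congr rfl fun r _ => mul_pow _ _ _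

variable [CompleteSpace 𝕂]

/-- **The derivative of the auxiliary function**: `(d/du) F_m = ∑ᵣ F_{m + eᵣ}` on the closed unit
disc (Baker 1975, p. 23: "`f_m(r)` is `(∂/∂z₀ + ⋯ + ∂/∂z_{n-1})^m Φ` on the diagonal").
[cite: BakerTNT1975, Ch. 2 Lemma 4] -/
theorem hasDerivAt_F (c : Idx S.n L → ℤ) (m : Fin S.n → ℕ) {z : 𝕂} (hz : ‖z‖ ≤ 1) :
    HasDerivAt (S.F c m) (∑ r, S.F c (bump m r) z) z := by
  have hterm : ∀ u : Idx S.n L, HasDerivAt (fun x => ((c u : 𝕂) * S.A u m) * exp (S.w u * x))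
      (∑ r, ((c u : 𝕂) * S.A u (bump m r)) * exp (S.w u * z)) z := by
    intro u
    have h1 := (hasDerivAt_exp_mul (p := p)
      (norm_mul_lt_of_norm_le_one (S.norm_w_lt u) hz)).const_mul ((c u : 𝕂) * S.A u m)
    refine h1.congr_deriv (Eq.symm ?_)
    calc ∑ r, ((c u : 𝕂) * S.A u (bump m r)) * exp (S.w u * z)
        = ∑ r, ((c u : 𝕂) * S.A u m) * (S.γ u r * S.ℓ (Fin.castSucc r)) * exp (S.w u * z) :=
          sum_congr rfl fun r _ => by rw [S.A_bump]; ring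
      _ = ((c u : 𝕂) * S.A u m) * (∑ r, S.γ u r * S.ℓ (Fin.castSucc r)) * exp (S.w u * z) := by
          rw [Finset.mul_sum, Finset.sum_mul]
      _ = ((c u : 𝕂) * S.A u m) * (S.w u * exp (S.w u * z)) := by
          rw [← S.w_eq_sum_γ]; ring
  unfold F
  refine (HasDerivAt.fun_sum fun u _ => hterm u).congr_deriv ?_
  rw [Finset.sum_comm]

/-- `F_m` is analytic at every point of the closed unit disc. [folklore] -/
theorem analyticAt_F (c : Idx S.n L → ℤ) (m : Fin S.n → ℕ) {a : 𝕂} (ha : ‖a‖ ≤ 1) :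
    AnalyticAt 𝕂 (S.F c m) a := by
  change AnalyticAt 𝕂 (fun z => ∑ u ∈ univ, ((c u : 𝕂) * S.A u m) * exp (S.w u * z)) a
  exact analyticAt_expSum (p := p) univ (fun u => (c u : 𝕂) * S.A u m) (fun u => S.w u)
    (fun u _ => S.norm_w_lt u) ha

/-- `deriv F_m = ∑ᵣ F_{m+eᵣ}` near every point of the open unit disc. [cite: BakerTNT1975, Ch. 2 Lemma 4] -/
theorem deriv_F_eventuallyEq (c : Idx S.n L → ℤ) (m : Fin S.n → ℕ) {a : 𝕂} (ha : ‖a‖ < 1) :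
    deriv (S.F c m) =ᶠ[𝓝 a] fun z => ∑ r, S.F c (bump m r) z := by
  filter_upwards [ball_one_mem_nhds ha] with z hz using (S.hasDerivAt_F c m (le_of_lt hz)).deriv

/-- **Vanishing of derivatives from vanishing of values** (Baker 1975, p. 23): if `F_{m'}(a) = 0`
whenever `|m'| ≤ T`, then `F_m^{(j)}(a) = 0` whenever `|m| + j ≤ T` (`‖a‖ < 1`).
[cite: BakerTNT1975, Ch. 2 Lemma 4] -/
theorem iteratedDeriv_F_eq_zero (c : Idx S.n L → ℤ) {a : 𝕂} (ha : ‖a‖ < 1) (T : ℕ)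
    (h : ∀ m : Fin S.n → ℕ, ∑ r, m r ≤ T → S.F c m a = 0) :
    ∀ (j : ℕ) (m : Fin S.n → ℕ), (∑ r, m r) + j ≤ T → iteratedDeriv j (S.F c m) a = 0 := by
  intro j
  induction j with
  | zero => intro m hm; simpa using h m (by simpa using hm)
  | succ j ih =>
    intro m hm
    rw [iteratedDeriv_succ', (S.deriv_F_eventuallyEq c m ha).iteratedDeriv_eq j,
      iteratedDeriv_fun_sum fun r _ => (S.analyticAt_F c (bump m r) ha.le).contDiffAt]
    refine sum_eq_zero fun r _ => ih _ ?_
    rw [sum_bump]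
    omega

/-! ### The values at the points `l · p` -/

/-- `exp (ψ_λ · l p) = ∏ᵢ αᵢ^{λᵢ l}` for a natural number `l`. [folklore] -/
theorem exp_w_mul_natMul (v : Idx S.n L) (l : ℕ) :
    exp (S.w v * ((l : 𝕂) * p)) = ∏ i, S.α i ^ ((v i : ℕ) * l) := by
  have e1 : S.w v * ((l : 𝕂) * p) = ∑ i, ((((v i : ℕ) * l : ℕ)) : 𝕂) * ((p : 𝕂) * S.ℓ i) := by
    unfold w
    rw [sum_mul]
    refine sum_congr rfl fun i _ => ?_
    push_cast
    ring
  rw [e1]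
  have hρp : ‖(p : 𝕂)‖ * S.ρ < (p : ℝ)⁻¹ :=
    (mul_le_of_le_one_left S.ρ_nonneg (IwasawaLog.norm_natCast_le_one p (F := 𝕂) p)).trans_lt
      S.ρ_lt
  have h := exp_sum_natCast_mul (p := p) univ (fun i => (p : 𝕂) * S.ℓ i)
    (fun i => (v i : ℕ) * l) (mul_nonneg (norm_nonneg _) S.ρ_nonneg) hρp fun i _ => by
      rw [norm_mul]
      exact mul_le_mul_of_nonneg_left (S.norm_ℓ_le_ρ i) (norm_nonneg _)
  simpa [α] using h

/-- **The values of the auxiliary function at the points `l·p`** (Baker 1975, p. 22, the display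
`f(l) = P ∑ p(λ) … α₁^{λ₁l} ⋯ αₙ^{λₙl} γ₁^{m₁} ⋯`):
`F c m (l p) = P_m · ∑_λ c(λ) (∏ᵣ γᵣ^{mᵣ}) (∏ᵢ αᵢ^{λᵢ l})`. [cite: BakerTNT1975, Ch. 2 Lemma 3] -/
theorem F_natMul (c : Idx S.n L → ℤ) (m : Fin S.n → ℕ) (l : ℕ) :
    S.F c m ((l : 𝕂) * p) =
      S.P m * ∑ u, (c u : 𝕂) * ((∏ r, S.γ u r ^ m r) * ∏ i, S.α i ^ ((u i : ℕ) * l)) := by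
  unfold F
  rw [mul_sum]
  refine sum_congr rfl fun u _ => ?_
  rw [S.exp_w_mul_natMul, S.A_eq]
  ring

/-! ### The `p`-adic extrapolation estimate -/

omit [CharZero 𝕂] [IsUltrametricDist 𝕂] [CompleteSpace 𝕂] in
/-- `‖p‖ = p⁻¹` in `𝕂`. [folklore] -/
theorem norm_prime : ‖(p : 𝕂)‖ = (p : ℝ)⁻¹ := by
  rw [IwasawaLog.norm_natCast p (F := 𝕂) p, Padic.norm_p]

omit [CharZero 𝕂] [IsUltrametricDist 𝕂] [CompleteSpace 𝕂] in
/-- The points `l · p` lie in the disc `‖u‖ ≤ p⁻¹`. [folklore] -/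
theorem norm_natMul_le (l : ℕ) : ‖(l : 𝕂) * p‖ ≤ (p : ℝ)⁻¹ := by
  rw [norm_mul, norm_prime (p := p)]
  exact mul_le_of_le_one_left (by positivity) (IwasawaLog.norm_natCast_le_one p (F := 𝕂) l)

omit [CharZero 𝕂] [IsUltrametricDist 𝕂] [CompleteSpace 𝕂] in
/-- The points `l · p` lie in the open unit disc. [folklore] -/
theorem norm_natMul_lt_one (l : ℕ) : ‖(l : 𝕂) * p‖ < 1 :=
  (norm_natMul_le (p := p) l).trans_lt
    (inv_lt_one_of_one_lt₀ (by exact_mod_cast (Fact.out : p.Prime).one_lt))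

omit [CharZero 𝕂] [IsUltrametricDist 𝕂] [CompleteSpace 𝕂] in
/-- Two points `l·p`, `l'·p` are within `p⁻¹` of each other. [folklore] -/
theorem norm_natMul_sub_natMul_le (l l' : ℕ) :
    ‖(l' : 𝕂) * p - (l : 𝕂) * p‖ ≤ (p : ℝ)⁻¹ := by
  rw [← sub_mul, norm_mul, norm_prime (p := p)]
  refine mul_le_of_le_one_left (by positivity) ?_
  have : (l' : 𝕂) - (l : 𝕂) = ((l' - l : ℤ) : 𝕂) := by push_cast; ring
  rw [this]
  exact PadicExp.norm_intCast_le_one (ℓ := p) _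

omit [IsUltrametricDist 𝕂] [CompleteSpace 𝕂] in
/-- `l ↦ (l+1)·p` is injective. [folklore] -/
theorem natMul_injOn (P₀ : ℕ) :
    Set.InjOn (fun l : ℕ => (((l + 1 : ℕ) : 𝕂)) * p) (range P₀ : Set ℕ) := by
  intro l _ l' _ h
  have hp0r : (0 : ℝ) < p := by exact_mod_cast (Fact.out : p.Prime).pos
  have hp0 : (p : 𝕂) ≠ 0 := fun h0 => by
    have h1 := norm_prime (p := p) (𝕂 := 𝕂)
    rw [h0, norm_zero] at h1
    exact (inv_pos.mpr hp0r).ne' h1.symm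
  have h2 : ((l + 1 : ℕ) : 𝕂) = ((l' + 1 : ℕ) : 𝕂) := mul_right_cancel₀ hp0 h
  have h3 : l + 1 = l' + 1 := by exact_mod_cast h2
  omega

/-- **The `p`-adic extrapolation estimate** (in place of the maximum-modulus step of Baker 1975,
Ch. 2, Lemma 4).  Suppose `F c m' (l p) = 0` for all `1 ≤ l ≤ P₀` and all `|m'| ≤ T`.  Then for
every `m` with `|m| + S ≤ T + 1` — so that `F_m` vanishes to order `≥ S` at each of these `P₀`
points of the disc `‖u‖ ≤ p⁻¹` — and every natural number `l'`,
`‖F c m (l' p)‖ ≤ ‖P_m‖ · p^{-P₀ S}` (ultrametric Schwarz lemma for the exponential sum `F_m`, whose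
coefficients have norm `≤ ‖P_m‖`, each factor `‖l'p − lp‖ ≤ p⁻¹`). [cite: BakerTNT1975, Ch. 2 Lemma 4] -/
theorem norm_F_natMul_le_of_vanishing (c : Idx S.n L → ℤ) {P₀ T : ℕ}
    (hvan : ∀ l : ℕ, 1 ≤ l → l ≤ P₀ → ∀ m' : Fin S.n → ℕ, ∑ r, m' r ≤ T →
      S.F c m' ((l : 𝕂) * p) = 0)
    (m : Fin S.n → ℕ) {S₀ : ℕ} (hmS : (∑ r, m r) + S₀ ≤ T + 1) (l' : ℕ) :
    ‖S.F c m ((l' : 𝕂) * p)‖ ≤ ‖S.P m‖ * ((p : ℝ)⁻¹) ^ (P₀ * S₀) := by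
  classical
  set s : Finset 𝕂 := (range P₀).image fun l : ℕ => (((l + 1 : ℕ) : 𝕂)) * p with hs_def
  have hs : ∀ a ∈ s, ‖a‖ < 1 := by
    intro a ha
    obtain ⟨l, -, rfl⟩ := mem_image.mp ha
    exact norm_natMul_lt_one (p := p) _
  have hS : ∀ a ∈ s, ∀ j < S₀, iteratedDeriv j (S.F c m) a = 0 := by
    intro a ha j hj
    obtain ⟨l, hl, rfl⟩ := mem_image.mp ha
    have hlP : l < P₀ := mem_range.mp hl
    exact S.iteratedDeriv_F_eq_zero c (norm_natMul_lt_one (p := p) _) T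
      (fun m' hm' => hvan (l + 1) (Nat.succ_pos l) hlP m' hm') j m (by omega)
  have h1 := norm_expSum_le_of_iteratedDeriv_eq_zero (p := p) univ
    (fun u => (c u : 𝕂) * S.A u m) (fun u => S.w u) (norm_nonneg (S.P m))
    (fun u _ => S.norm_coeff_le c u m) (fun u _ => S.norm_w_lt u) s hs S₀ hS
    (norm_natMul_lt_one (p := p) l')
  change ‖S.F c m ((l' : 𝕂) * p)‖ ≤ _ at h1
  refine h1.trans (mul_le_mul_of_nonneg_left ?_ (norm_nonneg _))
  rw [hs_def, prod_image (natMul_injOn (p := p) P₀)]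
  have hp0 : (0 : ℝ) ≤ (p : ℝ)⁻¹ := by positivity
  calc ∏ l ∈ range P₀, ‖(l' : 𝕂) * p - ((l + 1 : ℕ) : 𝕂) * p‖ ^ S₀
      ≤ ∏ _l ∈ range P₀, ((p : ℝ)⁻¹) ^ S₀ := by
        refine prod_le_prod (fun l _ => by positivity) fun l _ => ?_
        exact pow_le_pow_left₀ (norm_nonneg _) (norm_natMul_sub_natMul_le (p := p) _ _) _
    _ = ((p : ℝ)⁻¹) ^ (P₀ * S₀) := by
        rw [prod_const, card_range, ← pow_mul, mul_comm]

end Setup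

end BrumerPadic

end Literature.NumberTheory.Transcendental

end
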